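import Mathlib
import Literature.Computability.Complexity.PolynomialEntropyApproximation
import Literature.InformationTheory.Entropy.MapEntropy
import Literature.InformationTheory.Entropy.GibbsInequality
import Literature.InformationTheory.Entropy.LinearMapEntropy

/-!
# Sketch — first lemmas of the three crux-idea cards for `PeaTwoMemBPP` (stmt-PneNP-10778), ideator 3

All maps `q : F₂ⁿ → F₂ᵐ` are arbitrary functions `(Fin n → ZMod 2) → (Fin m → ZMod 2)`; "quadratic" enters
only through the hypothesis that the polarization `polar q · h` is linear (resp. symmetric), which is what a
sparse `PolyMapF2` of `DegLE 2` satisfies.  Statements only (`sorry`), to be proved by the line's stubs.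
-/

set_option linter.dupNamespace false

namespace Summit.PneNP.PneNP.Cruxes.PeaTwoMemBPP.Sketch

open Literature.InformationTheory.Entropy Literature.Computability.Complexity Finset

variable {n m : ℕ}

/-- Polarization `B(x,h) = q(x+h) + q(x) + q(h) + q(0)` (characteristic 2: `+ = −`).  For a quadratic map
it is bilinear, symmetric, alternating; `x ↦ B(x,h)` is the "directional derivative minus its constant". -/
def polar (q : (Fin n → ZMod 2) → (Fin m → ZMod 2)) (x h : Fin n → ZMod 2) : Fin m → ZMod 2 :=
  q (x + h) + q x + q h + q 0

/-! ## Card `polar-star-algebra-linearization` -/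

/-- **F₂ analogue of DGRV Lemma 5.1.**  If `x ↦ B(x,h)` is a linear map `L`, then `rank L ≤ 2·H(q(Uₙ))`:
`L(X)` is uniform on `range L` (entropy `= finrank`) and is a function of the pair `(q(X+h), q(X))`, each of
entropy `H(q(Uₙ))`.  Consequence used by the card: `crk_{F₂}` of the adjoint pencil `{B(·,h)}` is `≤ 2H`. -/
theorem finrank_range_polar_le_two_mul_entropy (q : (Fin n → ZMod 2) → (Fin m → ZMod 2))
    (h : Fin n → ZMod 2) (L : (Fin n → ZMod 2) →ₗ[ZMod 2] (Fin m → ZMod 2))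
    (hL : ∀ x, L x = polar q x h) :
    (Module.finrank (ZMod 2) (LinearMap.range L) : ℝ) ≤ 2 * mapEntropy Finset.univ q := by
  sorry

open scoped Classical in
/-- **Exact translation peeling** (the `E`-modulo-`U` identity in its simplest, radical, case): if
`q(x+u) = q(x) + φ(u)` for all `x` and all `u` in a subspace `U` (e.g. `U ≤ rad B`, `φ = q̃|_U` linear),
then the output law is invariant under the uniform translation by `W := φ(U)`, hence uniform on `W`-cosets,
and `H(q(Uₙ)) = dim W + H(π_W ∘ q (Uₙ))` — an exact reduction to a map with fewer output dimensions, no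
sampling and no loss.  The card's general step replaces `(U, W)` by an IQS shrunk subspace `(U, E ⊇ B(U,F₂ⁿ))`. -/
theorem mapEntropy_translation_peel (q : (Fin n → ZMod 2) → (Fin m → ZMod 2))
    (U : Submodule (ZMod 2) (Fin n → ZMod 2)) (φ : (Fin n → ZMod 2) →ₗ[ZMod 2] (Fin m → ZMod 2))
    (hU : ∀ x, ∀ u ∈ U, q (x + u) = q x + φ u) :
    mapEntropy Finset.univ q =
      Module.finrank (ZMod 2) (U.map φ) + mapEntropy Finset.univ (fun x => (U.map φ).mkQ (q x)) := by
  sorry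

/-! ## Card `orthogonality-kernel-walk` -/

/-- **Fibre differences through `x` in direction `h` form an affine subspace**: `{x : q(x+h) = q(x)}` is
`{x : B(x,h) = q(h) + q(0)}`, empty or a coset of `ker L`, so its size is `0` or `2^{n − rank L}`.  Hence
`2ⁿ·CP(q) = E_x #{x' : q x' = q x} = Σ_h c(h)·2^{−ρ(h)}` with `c(h) ∈ {0,1}` and `ρ(h) = rank B(·,h)` — the
collision measure on directions that the kernel walk samples from. -/
theorem card_shiftCollision_eq (q : (Fin n → ZMod 2) → (Fin m → ZMod 2)) (h : Fin n → ZMod 2)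
    (L : (Fin n → ZMod 2) →ₗ[ZMod 2] (Fin m → ZMod 2)) (hL : ∀ x, L x = polar q x h) :
    (Finset.univ.filter fun x => q (x + h) = q x).card = 0 ∨
      (Finset.univ.filter fun x => q (x + h) = q x).card =
        2 ^ (n - Module.finrank (ZMod 2) (LinearMap.range L)) := by
  sorry

/-- **Kernel-walk importance identity** (detailed balance in summed form).  With `K x := {z : B(x,z) = 0}`
and `B` symmetric, `Σ_x Σ_{z ∈ K x} f z = Σ_z |K z| · f z`; since `|K z| = 2^{n−ρ(z)}`, sampling `x`
uniformly and then `z` uniformly in the subspace `K x` (exact linear algebra) is an unbiased importance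
sampler for the rank-weighted census `Σ_z 2^{−ρ(z)} f(z)` — including its uniformly-invisible heavy
tail — and the walk `x → Unif(K x)` is reversible with stationary law `π(z) ∝ 2^{−ρ(z)}`. -/
theorem kernelWalk_importance_identity (q : (Fin n → ZMod 2) → (Fin m → ZMod 2))
    (hsymm : ∀ x z, polar q x z = polar q z x) (f : (Fin n → ZMod 2) → ℝ) :
    (∑ x : Fin n → ZMod 2, ∑ z ∈ Finset.univ.filter (fun z => polar q x z = 0), f z) =
      ∑ z : Fin n → ZMod 2, ((Finset.univ.filter fun x => polar q x z = 0).card : ℝ) * f z := by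
  sorry

/-! ## Card `gibbs-one-sided-modeling` -/

/-- **Gibbs / cross-entropy soundness.**  For ANY sub-probability evaluator `h` on the outputs,
`H(f(U)) ≤ E_x[−log₂ h(f x)]`: the cross-entropy of the true output law against `h`.  So "reject iff some
constructed model has empirical cross-entropy ≤ k + ½" never rejects a yes-instance (`H ≥ k+1`), whatever
the model; completeness (= the crux) becomes a pure MODELING statement about degree-2 pushforwards. -/
theorem mapEntropy_le_crossEntropy {β : Type*} [Fintype β] [DecidableEq β]
    (f : (Fin n → ZMod 2) → β) (h : β → ℝ) (hpos : ∀ y, 0 < h y) (hsum : ∑ y, h y ≤ 1) :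
    mapEntropy Finset.univ f ≤
      (∑ x : Fin n → ZMod 2, -Real.logb 2 (h (f x))) / Fintype.card (Fin n → ZMod 2) := by
  sorry

end Summit.PneNP.PneNP.Cruxes.PeaTwoMemBPP.Sketch
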